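import Summits.MatrixMultiplication.OmegaCensus.BoxUsefulDihedral
import Summits.MatrixMultiplication.OmegaCensus.DihedralUniform

/-!
# ω-census, family (b3): conjecture C9 on the dihedral family — CLASSIFICATION: `DihedralGroup n` is box-useful iff `n ∈ {1, 2, 3, 4, 6}`

HONEST FRAMING (pub-omega census; verbatim): lottery ticket; floor = certified bounds/negative ranges.
Census BOOKKEEPING (conjecture C9 of the cell; pub-omega stpp-1 gen 18): assembling `DihedralUniform`
(`not_boxUseful_dihedral_of_le`: every `n ≥ 35`, by the truncated 8-periodic construction) and `BoxUsefulDihedral`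
(`not_boxUseful_dihedral_of_small_dvd`: every `n` with a divisor among `5, 7, 8, 9, 11, 12, 13, 17, 19, 23, 29, 31` — which
covers every `5 ≤ n ≤ 34` except `n = 6` —, and `boxUseful_dihedral_one/two/three/four/six`):
* `not_boxUseful_dihedral`: `DihedralGroup n` is NOT box-useful for every `n ≥ 5`, `n ≠ 6`;
* `boxUseful_dihedral_iff`: **for every `n ≥ 1`, `BoxUseful (DihedralGroup n) ↔ n ∈ {1, 2, 3, 4, 6}`** — the box-useful
  dihedral groups are exactly the abelian ones (`D_2`, `D_4`), the centre-index-`4` one (`D_8`) and the centre-index-`6`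
  ones (`D_6 ≅ S₃`, `D_12`): conjecture C9 (b) ('box-useful ⇒ abelian, centre index 4 or 6, or class 𝒞₂') HOLDS on the
  whole dihedral family, in the kernel.
Nothing here is progress on `ω`.
-/

namespace Summit.MatrixMultiplication.OmegaCensus

open Finset ProductBoxBound DihedralGroup

/-- A divisor from the kernel list `5, 7, 8, 9, 11, 12, 13, 17, 19, 23, 29, 31` (meaningful for `5 ≤ n ≤ 34`, `n ≠ 6`). [folklore] -/
def smallDiv (n : ℕ) : ℕ :=
  if 5 ∣ n then 5 else if 7 ∣ n then 7 else if 8 ∣ n then 8 else if 9 ∣ n then 9 else if 11 ∣ n then 11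
  else if 12 ∣ n then 12 else if 13 ∣ n then 13 else if 17 ∣ n then 17 else if 19 ∣ n then 19 else if 23 ∣ n then 23
  else if 29 ∣ n then 29 else 31

/-- Every `5 ≤ n ≤ 34`, `n ≠ 6`, has a divisor in the kernel list. [folklore] -/
theorem smallDiv_spec : ∀ n < 35, 5 ≤ n → n ≠ 6 →
    (smallDiv n = 5 ∨ smallDiv n = 7 ∨ smallDiv n = 8 ∨ smallDiv n = 9 ∨ smallDiv n = 11 ∨ smallDiv n = 12 ∨
      smallDiv n = 13 ∨ smallDiv n = 17 ∨ smallDiv n = 19 ∨ smallDiv n = 23 ∨ smallDiv n = 29 ∨ smallDiv n = 31) ∧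
    smallDiv n ∣ n := by
  intro n hn
  interval_cases n <;> decide

open DihedralUniform in
/-- **`DihedralGroup n` is not box-useful for every `n ≥ 5`, `n ≠ 6`.** (`n ≥ 35`: the uniform construction; `5 ≤ n ≤ 34`:
a divisor among `5, 7, 8, 9, 11, 12, 13, 17, 19, 23, 29, 31` and the kernel witnesses of `BoxUsefulDihedral`.) [folklore] -/
theorem not_boxUseful_dihedral {n : ℕ} [NeZero n] (h5 : 5 ≤ n) (h6 : n ≠ 6) : ¬ BoxUseful (DihedralGroup n) := by
  rcases le_or_gt 35 n with hn | hn
  · exact not_boxUseful_dihedral_of_le hn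
  · obtain ⟨hm, hmn⟩ := smallDiv_spec n hn h5 h6
    exact not_boxUseful_dihedral_of_small_dvd hm hmn

/-- **CLASSIFICATION of the dihedral family under C9: `DihedralGroup n` (`n ≥ 1`) is box-useful iff `n ∈ {1, 2, 3, 4, 6}`** —
exactly the abelian (`n = 1, 2`), centre-index-`4` (`n = 4`) and centre-index-`6` (`n = 3, 6`) members, as conjecture C9 (b)
predicts. [folklore] -/
theorem boxUseful_dihedral_iff {n : ℕ} [NeZero n] :
    BoxUseful (DihedralGroup n) ↔ n = 1 ∨ n = 2 ∨ n = 3 ∨ n = 4 ∨ n = 6 := by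
  constructor
  · intro h
    by_contra hne
    push Not at hne
    obtain ⟨h1, h2, h3, h4, h6⟩ := hne
    have hn0 : n ≠ 0 := NeZero.ne n
    exact not_boxUseful_dihedral (by omega) h6 h
  · rintro (rfl | rfl | rfl | rfl | rfl)
    · exact boxUseful_dihedral_one
    · exact boxUseful_dihedral_two
    · exact boxUseful_dihedral_three
    · exact boxUseful_dihedral_four
    · exact boxUseful_dihedral_six

end Summit.MatrixMultiplication.OmegaCensus
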